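import Literature.NumberTheory.EllipticCurves.NewformsStrongMultiplicityOneProofs
import Literature.NumberTheory.EllipticCurves.NewformsFiniteProofs
import Literature.NumberTheory.EllipticCurves.NewformsHeckeProofs
import Literature.NumberTheory.EllipticCurves.ModularJacobianModPMultiplicityOne
import Literature.NumberTheory.EllipticCurves.CuspFormLFunction
import Mathlib.LinearAlgebra.Dual.Defs
import HarnessLib

/-!
# Dual separation for a newform: a functional on `S_k(Γ₀(N))` killed by powers of `(T_q^∨ − a_q(f))` for finitely many
# well-chosen primes `q ∤ N` and vanishing at the newform `f` is zero

Topic `Literature/NumberTheory/EllipticCurves` (next to the Atkin–Lehner files it assembles); namespace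
`Literature.NumberTheory.EllipticCurves.ModularForms`.  Proved theorems only (no definition, no named fact, no `sorry`, no
instance, no notation).  Everything used is PROVED in the tree: the Atkin–Lehner decomposition
`S_k(Γ₀(N)) = Σ_{M d ∣ N} [α_d]_k S_k(Γ₀(M))^{new}` (`iSup_atkinLehnerComponent_eq_top`), the newform bases
(`span_newforms0_holds`, `finite_newforms0_holds`), `T_q [α_d] g = a_q(g) [α_d] g` for `q ∤ N` (`heckeT_degeneracyMap0`,
`IsNewform0.heckeT_eq_coeff_smul`), and strong multiplicity one across levels
(`IsNewform0.level_eq_of_heckeEigenvalue_eq_holds`, `IsNewform0.eq_of_heckeEigenvalue_eq_holds`).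

* `dual_pow_sub_apply_of_eigen`, `dual_apply_eq_zero_of_eigen` — linear algebra: a functional killed by `(T^∨ − a)^n`
  vanishes on `T`-eigenvectors with eigenvalue `b ≠ a`;
* `finite_atkinLehnerIndex'` — `{(M, d) : M d ∣ N}` is finite;
* **`exists_dualSeparation_of_isNewform0`** — for a newform `f ∈ S_k(Γ₀(N))` and a finite set `P` of primes to avoid there is a
  finite set `s` of primes `q ∤ N`, `q ∉ P`, such that every `ψ ∈ S_k(Γ₀(N))^∨` with `(T_q^∨ − a_q(f))^{n_q} ψ = 0` (`q ∈ s`) and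
  `ψ(f) = 0` is zero (for each newform `g ≠ f` of level `M ∣ N` pick `q ∤ N·P` with `a_q(g) ≠ a_q(f)`; on `[α_d] g` the operator
  `T_q − a_q(f)` is the nonzero scalar `a_q(g) − a_q(f)`; the only unseparated generator is `f` itself);
* **`exists_dualSeparation_of_isNewformOf`** — the same for the newform of an elliptic curve `W/ℚ`, with INTEGER eigenvalues
  `a_q = a_q(W)` and the Hecke operators written as `HeckeRing0.toEnd (HeckeRing0.T q)`: verbatim the hypothesis `hDS` of
  `Summit.…TeichmullerTwistDescent.KOfDualSeparation.twistedPeriodLatticeSaturation_of_dualSeparation`.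

## References
* A. O. L. Atkin, J. Lehner, *Hecke operators on `Γ₀(m)`*, Math. Ann. 185 (1970), Thm. 3, Thm. 4, Thm. 5. [AtkinLehner1970]
* F. Diamond, J. Shurman, *A First Course in Modular Forms* (2005), Thm. 5.8.2, Thm. 5.8.3, Prop. 5.8.5. [DiamondShurman2005]
-/

noncomputable section

open scoped MatrixGroups ModularForm

open CongruenceSubgroup UpperHalfPlane

namespace Literature.NumberTheory.EllipticCurves.ModularForms

/-! ### Linear algebra: functionals killed by `(T^∨ − a)^n` -/

/-- `((T^∨ − a)^n ψ)(v) = (b − a)^n ψ(v)` for a `T`-eigenvector `v` with eigenvalue `b`. [cite: DiamondShurman2005, Thm. 5.8.3] -/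
theorem dual_pow_sub_apply_of_eigen {V : Type*} [AddCommGroup V] [Module ℂ V] (T : Module.End ℂ V) {a b : ℂ} {v : V}
    (hv : T v = b • v) (n : ℕ) (ψ : Module.Dual ℂ V) :
    (((T.dualMap - a • 1) ^ n) ψ) v = (b - a) ^ n * ψ v := by
  induction n generalizing ψ with
  | zero => simp
  | succ n ih =>
    rw [pow_succ, Module.End.mul_apply, ih, LinearMap.sub_apply, LinearMap.sub_apply, LinearMap.dualMap_apply,
      LinearMap.smul_apply, LinearMap.smul_apply, Module.End.one_apply, hv, map_smul, smul_eq_mul, smul_eq_mul, pow_succ]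
    ring

/-- **A functional killed by `(T^∨ − a)^n` vanishes on `T`-eigenvectors with eigenvalue `b ≠ a`.** [cite: DiamondShurman2005, Thm. 5.8.3] -/
theorem dual_apply_eq_zero_of_eigen {V : Type*} [AddCommGroup V] [Module ℂ V] (T : Module.End ℂ V) (ψ : Module.Dual ℂ V)
    {a b : ℂ} (hab : b ≠ a) {n : ℕ} (hψ : ((T.dualMap - a • 1) ^ n) ψ = 0) {v : V} (hv : T v = b • v) : ψ v = 0 := by
  have h := dual_pow_sub_apply_of_eigen T (a := a) hv n ψ
  rw [hψ, LinearMap.zero_apply] at h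
  rcases mul_eq_zero.mp h.symm with h1 | h1
  · exact absurd (pow_eq_zero_iff'.mp h1).1 (sub_ne_zero.mpr hab)
  · exact h1

/-! ### The separating primes -/

/-- The Atkin–Lehner index set `{(M, d) : M d ∣ N}` is finite (as in `PastenCongruenceModulusSizeProofs`). [folklore] -/
private theorem finite_atkinLehnerIndex' (N : ℕ) [NeZero N] : Finite (AtkinLehnerIndex N) := by
  have h : {x : ℕ × ℕ | x.1 * x.2 ∣ N}.Finite := by
    refine (Finset.finite_toSet (Finset.range (N + 1) ×ˢ Finset.range (N + 1))).subset ?_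
    intro x hx
    have h1 : x.1 ∣ N := (dvd_mul_right _ _).trans hx
    have h2 : x.2 ∣ N := (dvd_mul_left _ _).trans hx
    simp only [Finset.coe_product, Finset.coe_range, Set.mem_prod, Set.mem_Iio]
    exact ⟨Nat.lt_succ_of_le (Nat.le_of_dvd (NeZero.pos N) h1), Nat.lt_succ_of_le (Nat.le_of_dvd (NeZero.pos N) h2)⟩
  exact h.to_subtype

variable {N : ℕ} [NeZero N] {k : ℤ}

/-- **Dual separation for a newform.**  For a newform `f ∈ S_k(Γ₀(N))` and a finite set `P` of primes to avoid there is a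
finite set `s` of primes `q ∤ N`, `q ∉ P`, such that every functional `ψ` on `S_k(Γ₀(N))` killed by some power of each
`T_q^∨ − a_q(f)` (`q ∈ s`) and vanishing at `f` is zero. [cite: AtkinLehner1970, Thm. 4 and Thm. 5; DiamondShurman2005, Thm. 5.8.3] -/
theorem exists_dualSeparation_of_isNewform0 {f : CuspForm (Gamma0 N) k} (hf : IsNewform0 f) (P : Finset ℕ) :
    ∃ s : Finset {q : ℕ // q.Prime ∧ ¬ q ∣ N ∧ q ∉ P},
      ∀ ψ : Module.Dual ℂ (CuspForm (Gamma0 N) k),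
        (∀ q ∈ s, ∃ n : ℕ,
          ((((haveI : NeZero q.1 := ⟨q.2.1.ne_zero⟩; heckeT (Gamma0 N) k q.1)).dualMap -
              (qExpansion 1 ⇑f).coeff q.1 • 1) ^ n) ψ = 0) →
        ψ f = 0 → ψ = 0 := by
  classical
  haveI : Finite (AtkinLehnerIndex N) := finite_atkinLehnerIndex' N
  haveI : Fintype (AtkinLehnerIndex N) := Fintype.ofFinite _
  -- the separating-prime chooser
  let c : (x : AtkinLehnerIndex N) → CuspForm (Gamma0 x.1.1) k → Option {q : ℕ // q.Prime ∧ ¬ q ∣ N ∧ q ∉ P} :=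
    fun x g =>
      if h : ∃ q : ℕ, q.Prime ∧ ¬ q ∣ N ∧ q ∉ P ∧ (qExpansion 1 ⇑g).coeff q ≠ (qExpansion 1 ⇑f).coeff q then
        some ⟨h.choose, h.choose_spec.1, h.choose_spec.2.1, h.choose_spec.2.2.1⟩
      else none
  let s : Finset {q : ℕ // q.Prime ∧ ¬ q ∣ N ∧ q ∉ P} :=
    Finset.univ.biUnion fun x : AtkinLehnerIndex N =>
      Finset.eraseNone (((finite_newforms0_holds x.1.1 k).toFinset).image (c x))
  refine ⟨s, fun ψ hψ hψf => ?_⟩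
  -- `ψ` vanishes on every Atkin–Lehner generator `[α_d]_k g`
  have hgen : ∀ (x : AtkinLehnerIndex N) (g : CuspForm (Gamma0 x.1.1) k), IsNewform0 g →
      ψ (degeneracyMap0 x.1.1 N x.1.2 k g) = 0 := by
    intro x g hg
    by_cases hsep : ∃ q : ℕ, q.Prime ∧ ¬ q ∣ N ∧ q ∉ P ∧ (qExpansion 1 ⇑g).coeff q ≠ (qExpansion 1 ⇑f).coeff q
    · -- separated by the chosen prime `q₀ ∈ s`
      set q₀ : {q : ℕ // q.Prime ∧ ¬ q ∣ N ∧ q ∉ P} :=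
        ⟨hsep.choose, hsep.choose_spec.1, hsep.choose_spec.2.1, hsep.choose_spec.2.2.1⟩
      have hc : c x g = some q₀ := dif_pos hsep
      have hq₀s : q₀ ∈ s := by
        simp only [s, Finset.mem_biUnion, Finset.mem_univ, true_and, Finset.mem_eraseNone, Finset.mem_image]
        exact ⟨x, g, (finite_newforms0_holds _ k).mem_toFinset.mpr hg, hc⟩
      obtain ⟨n, hn⟩ := hψ q₀ hq₀s
      haveI : NeZero hsep.choose := ⟨hsep.choose_spec.1.ne_zero⟩
      have hev : heckeT (Gamma0 N) k hsep.choose (degeneracyMap0 x.1.1 N x.1.2 k g) =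
          (qExpansion 1 ⇑g).coeff hsep.choose • degeneracyMap0 x.1.1 N x.1.2 k g := by
        rw [heckeT_degeneracyMap0 x.2 hsep.choose_spec.1 hsep.choose_spec.2.1 g,
          hg.heckeT_eq_coeff_smul hsep.choose_spec.1, map_smul]
      exact dual_apply_eq_zero_of_eigen _ ψ hsep.choose_spec.2.2.2 hn hev
    · -- not separated: `g = f` (strong multiplicity one) and `d = 1`
      push Not at hsep
      obtain ⟨⟨M, d⟩, hMd⟩ := x
      haveI hM0 : NeZero M := AtkinLehnerIndex.neZero_fst N ⟨(M, d), hMd⟩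
      haveI hd0 : NeZero d := AtkinLehnerIndex.neZero_snd N ⟨(M, d), hMd⟩
      change ψ (degeneracyMap0 M N d k g) = 0
      have hfin : {q : ℕ | q.Prime ∧ heckeEigenvalue g q ≠ heckeEigenvalue f q}.Finite := by
        refine (Finset.finite_toSet (N.divisors ∪ P)).subset ?_
        rintro q ⟨hq, hne⟩
        rw [Finset.coe_union, Set.mem_union, Finset.mem_coe, Finset.mem_coe, Nat.mem_divisors]
        by_contra hcon
        push Not at hcon
        apply hne
        rw [heckeEigenvalue_eq_coeff_of_isNormalized hg.2.2 hq (hg.2.1 q hq),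
          heckeEigenvalue_eq_coeff_of_isNormalized hf.2.2 hq (hf.2.1 q hq)]
        exact hsep q hq (fun h => NeZero.ne N (hcon.1 h)) hcon.2
      have hMN : M = N := IsNewform0.level_eq_of_heckeEigenvalue_eq_holds hg hf hfin
      subst hMN
      have hgf : g = f := IsNewform0.eq_of_heckeEigenvalue_eq_holds hg hf hfin
      have hd1 : d = 1 := by
        have hle : M * d ≤ M * 1 := by rw [mul_one]; exact Nat.le_of_dvd (NeZero.pos M) hMd
        have hd := NeZero.ne d
        have := Nat.le_of_mul_le_mul_left hle (NeZero.pos M)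
        omega
      subst hd1
      have e : degeneracyMap0 M M 1 k g = g := DFunLike.ext' (coe_degeneracyMap0_one M M k dvd_rfl g)
      rw [e, hgf]
      exact hψf
  -- conclude with the Atkin–Lehner decomposition
  have htop : (⊤ : Submodule ℂ (CuspForm (Gamma0 N) k)) ≤ LinearMap.ker ψ := by
    rw [← iSup_atkinLehnerComponent_eq_top k N]
    refine iSup_le fun x => ?_
    rw [atkinLehnerComponent, ← span_newforms0_holds x.1.1 k, Submodule.map_span, Submodule.span_le]
    rintro _ ⟨g, hg, rfl⟩
    exact LinearMap.mem_ker.mpr (hgen x g hg)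
  ext v
  exact LinearMap.mem_ker.mp (htop (Submodule.mem_top : v ∈ ⊤))

/-- **Dual separation for the newform of an elliptic curve**, with integer eigenvalues `a_q = a_q(W)` and the Hecke
operators as elements of `𝕋 = HeckeRing0 N 2` — verbatim the hypothesis `hDS` of the K-line adapter
`Summit.…TeichmullerTwistDescent.KOfDualSeparation`: for any `p` there are finitely many primes `q_i ≠ p` (indeed `q_i ∤ N`)
with `T_{q_i} f = a_{q_i}(W) f` such that every functional killed by powers of the `(T_{q_i}^∨ − a_{q_i}(W))` and vanishing at
`f` is zero. [cite: AtkinLehner1970, Thm. 4 and Thm. 5; DiamondShurman2005, Thm. 5.8.3] -/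
theorem exists_dualSeparation_of_isNewformOf (W : WeierstrassCurve ℚ) {f : CuspForm (Gamma0 N) 2} (hf : IsNewformOf W f)
    (p : ℕ) :
    ∃ (s : Finset {q : ℕ // q.Prime ∧ q ≠ p}) (a : {q : ℕ // q.Prime ∧ q ≠ p} → ℤ),
      (∀ i ∈ s, HeckeRing0.toEnd N 2 (HeckeRing0.T N 2 i.1 i.2.1) f = (a i : ℂ) • f) ∧
      ∀ ψ : Module.Dual ℂ (CuspForm (Gamma0 N) 2),
        (∀ i ∈ s, ∃ n : ℕ, (((HeckeRing0.toEnd N 2 (HeckeRing0.T N 2 i.1 i.2.1)).dualMap - (a i : ℂ) • 1) ^ n) ψ = 0) →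
          ψ f = 0 → ψ = 0 := by
  classical
  obtain ⟨s₀, hs₀⟩ := exists_dualSeparation_of_isNewform0 hf.1 {p}
  have hne : ∀ q : {q : ℕ // q.Prime ∧ ¬ q ∣ N ∧ q ∉ ({p} : Finset ℕ)}, q.1 ≠ p := fun q h =>
    q.2.2.2 (Finset.mem_singleton.mpr h)
  let e : {q : ℕ // q.Prime ∧ ¬ q ∣ N ∧ q ∉ ({p} : Finset ℕ)} → {q : ℕ // q.Prime ∧ q ≠ p} :=
    fun q => ⟨q.1, q.2.1, hne q⟩
  have hcoef : ∀ (q : ℕ) (hq : q.Prime), (qExpansion 1 ⇑f).coeff q = ((W.LFunction q : ℤ) : ℂ) := fun q _ => hf.2 q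
  refine ⟨s₀.image e, fun i => W.LFunction i.1, fun i hi => ?_, fun ψ hψ hψf => hs₀ ψ (fun q hq => ?_) hψf⟩
  · haveI : NeZero i.1 := ⟨i.2.1.ne_zero⟩
    rw [HeckeRing0.toEnd_T, hf.1.heckeT_eq_coeff_smul i.2.1, hcoef i.1 i.2.1]
  · obtain ⟨n, hn⟩ := hψ (e q) (Finset.mem_image_of_mem e hq)
    refine ⟨n, ?_⟩
    haveI : NeZero q.1 := ⟨q.2.1.ne_zero⟩
    rw [HeckeRing0.toEnd_T, ← hcoef q.1 q.2.1] at hn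
    exact hn

end Literature.NumberTheory.EllipticCurves.ModularForms
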